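import Summits.Ventures.HSemireg.Pad4TowerPsiSubA1

/-!
# Venture HSemireg — monad-4 g3: the SURPLUS LADDER for (B3♯) — Hall margins per base-locus stratum, necessary and
# sufficient rungs for «a GENERIC box-monad map is onto ∕ a sub-bundle EVERYWHERE», flow certificates, and the typed hook of
# the block-Porteous rows (BP)

HONEST FRAMING.  Evidence cell `pub-hsemireg`, unit `hsemireg-monad-4` gen 3 (planner, MECH pen + typing; director-hodge g20
MINT block A3, task «(B3)∕(α′)»).  Line of record (D-0145): stmt-HodgeConjecture-18881
`Cruxes/BlochSeedDiscOne/Lines/birth.lean` 814a6a70c14e831a, stub `stub_rung_pad4_seedAt` — UNTOUCHED.  This file is the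
Lean PREDICATE SPEC of the g3 memo `B3SHARP-SURPLUS-LADDER-monad4-g3.md` (same folder of the crux workfiles): DEFINITIONS with
bodies and PROVED combinatorial lemmas about finite «box designs» (three finite sets of cells `A, N, C` with integer
multiplicities and a live relation `L`).  It continues g2's `B3MonadCohomology.lean` (7bca63b05d81264e; NOT importable on the
farm from a crux workfile, rc 75 `stale:unbuilt`, hence the vocabulary is RESTATED here generically over a cell type `V`:
`BoxDesign MCell` is field for field g2's `BoxMonad`, and `mass ∕ nbC ∕ nbA ∕ HallQ ∕ HallI ∕ StrictHallQ ∕ StrictHallI` have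
the same bodies).  NOTHING HERE IS PROVED TOWARD HC ∕ HC_CM ∕ HC_AV ∕ №4 ∕ stmt-26512 ∕ stmt-18881 ∕ (H2); no rung, no seed, no
variety, sheaf or abelian variety appears; the algebro-geometric content (THEOREM Q∕I, the block-Porteous rows, the base-locus
table) is PEN, in the memo, with its sources.  No `sorry`, no `instance`, no notation, no banned option.

THE DICTIONARY (pen, memo §1–§4; what the predicates below MODEL).  `X = S⁴`, `S = E_i × E_{−i}`; a cell `Z` is a box line
bundle `L_Z`; a design is `𝒜 = ⊕ m_A(Z) L_Z`, `𝒩 = ⊕ m_N(Z) L_Z`, `𝒞 = ⊕ m_C(Z) L_Z`; a monad is `𝒜 —i→ 𝒩 —q→ 𝒞`, `q ∘ i = 0`,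
`E = ker q ∕ im i`.  DEGENERACY HALF OF (B3): `E` is locally free of the designed rank `iff` `q` is onto at every point and `i`
is a sub-bundle at every point (then `c(E) = c(𝒩)c(𝒜)⁻¹c(𝒞)⁻¹` is automatic).  At a point `p ∈ X` the fibre map `q(p)` is a
PATTERN MATRIX: its block `(n → c)` can be non-zero only if the arc is LIVE AT `p`, i.e. `H⁰(Hom(L_n, L_c)) ≠ 0` (the relation
`L`, for the aligned labelling `= MCell.le`) AND `p ∉ Bs|Hom(L_n, L_c)|`.  The base loci stratify `X`: on a stratum `Σ` the live
pattern is `L_Σ ⊆ L` (`offWall L W_Σ` below).  For a `C`-block `Γ` put `N_Σ(Γ)` = its feeders under `L_Σ` and the SURPLUS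
`s_Σ(Γ) = m_N(N_Σ(Γ)) − m_C(Γ)` (`surplusC`).  THE LADDER (memo THEOREM Q + LEMMA N):
* NECESSARY (any `q` onto everywhere): `s_Σ(Γ) ≥ 0` for every non-empty `Γ` and every NON-EMPTY stratum `Σ` (`MarginQ L_Σ D 0`;
  on the open stratum this is g0∕g2's Hall row, on the walls it is monad-1's joint test KJ);
* SUFFICIENT (generic `q` onto everywhere): `s_Σ(Γ) ≥ dim Σ` for every non-empty `Γ` and every stratum (`MarginQ L_Σ D (dim Σ)`),
  because the non-surjective pattern matrices of pattern `L_Σ` have codimension `≥ min_Γ s_Σ(Γ) + 1` (THEOREM Q: a covector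
  with support `T ⊆ Γ`-copies kills `|N(T)|`-many independent columns; union over `ℙ(T)` costs `|T| − 1`);
* IN BETWEEN (`0 ≤ s < dim Σ`): the BLOCK-PORTEOUS rows (BP) `c_{s+1}(𝒩_{N(Γ)} − 𝒞_Γ) = 0 ∈ H^{2s+2}(X, ℚ)` are NECESSARY for
  every block with `s(Γ) = s ≤ 7` (Fulton, Intersection Theory, Thm 14.4(a): an everywhere-onto `σ_Γ : 𝒩_{N(Γ)} → 𝒞_Γ` has empty
  top degeneracy locus, whose class is `±c_{s+1}` of the virtual difference), and on the open stratum in the base-point-free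
  regime they are also SUFFICIENT (Thm 14.4(b) + induction on minimal blocks; memo THEOREM BP-EXACT).  The `s = 0` row is g2's
  `c₁` face of the tight-block law; `(BP)_s` for `s ≥ 1` needs the cup product of the class frame, which the tree does not carry
  — only its DATUM `blockChQ` (the Chern character of the virtual block bundle in the frame of record) and the `s = 0` row
  `BPZeroQ` are typed here (§7).
The `i`-side is the transpose throughout (`nbA`, `surplusA`, `MarginI`, …; Fulton Ex. 14.4.1).

CONTENT (all PROVED).
* §1 `BoxDesign`, `mass`, `nbC ∕ nbA`, `surplusC ∕ surplusA`, `HallQ ∕ HallI`, `StrictHallQ ∕ StrictHallI`, **`MarginQ ∕ MarginI`**.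
* §2 `hallQ_iff_marginQ_zero`, `strictHallQ_iff_marginQ_one` (+ `I` twins): margins 0 and 1 ARE g2's Hall and strict-Hall rows;
  `marginQ_mono` (the ladder is monotone in the rung); `nbC_mono`, `surplusC_mono_rel`, **`marginQ_of_finer`**: a margin under a
  FINER pattern implies the same margin under any coarser one (so NECESSARY rungs may be checked on the coarse relation of record,
  SUFFICIENT rungs must be checked on the true pattern — memo §2 CAVEAT L).
* §3 strata: `offWall L W` (the pattern off a wall set `W`), `offWall_le`, `marginQ_offWall`; the ladder `LadderQ ∕ LadderI` over a
  stratum index with rung function `d`, `ladderQ_mono`, `necessary_of_sufficient` (rungs `dim Σ ≥ 0`).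
* §4 CERTIFICATES: `FlowCertQ L D k` (a non-negative integral supply flow on live arcs meeting every demand with private margin
  `k`) and **`marginQ_of_flowCert`** (weak duality: a flow certificate proves the rung `k`; this is unipotent-1 g7's LEMMA SUP as
  the special case `k = 8`, `marginQ_eight_of_plan`); `not_marginQ_of_block` (a printed block with small surplus refutes a rung)
  — the two kernel-checkable certificate shapes the machine table (`g3/code/ladder.py`) prints.
* §5 SUP ⊊ LADDER: the toy `supToy` (`𝒪^{10} → L₁ ⊕ L₂`: one feeder of mass 10, two receivers of mass 1) has `MarginQ 8`
  (`decide`) but NO flow certificate with private margin 8 (`supToy_no_flowCert`): the sufficient rung is strictly weaker than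
  a private-copies plan.
* §6 the cell's instance `V = MCell`, relation of record `MCell.le`: `marginQ_le_of_sub` (necessary rungs transfer to `MCell.le`).
* §7 `blockChQ ∕ blockChA` (class-frame Chern character of the virtual block bundles, over `ℤ[i]`, through the tree's `MCell.ch`)
  and the surplus-0 Porteous rows `BPZeroQ ∕ BPZeroA` (degree-one words vanish).

SOURCES.  memo `B3SHARP-SURPLUS-LADDER-monad4-g3.md` (this gen); g2 `B3MonadCohomology.lean` 7bca63b05d81264e + memo v2.1
208710c57c083d30; g0 memo v1.2 39be82d7e89d1615; unipotent-1 g7 `U-ALLPOINTS-unipotent1-g7.md` (LEMMA SUP, VALUE LAW); monad-1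
`B1SHARP-KILL` f6b5677c (KJ); Fulton, Intersection Theory 2nd ed., Thm 14.4, Ex. 14.4.1, Ex. 12.1.6 [corpus:book:fultonnd-
intersection-theory p0246–0247, p0210]; Birkenhake–Lange, Complex Abelian Varieties, Thm 1.6.4∕Cor 1.6.5 (p0066), Prop 2.1.5
(p0078), Lemma 5.1.1∕5.1.2 (p0242) [corpus:book:lange1992-complex-abelian-varieties]; tree `Pad4TowerPsiSubA1` (`MCell.ch`),
`Pad4TowerCrossPhase` (`MCell`, `MCell.le`), `Pad4TowerClassScreen` (`CWord`, `wdeg`).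
-/

set_option linter.dupNamespace false

namespace Summit.HodgeConjecture.HodgeConjecture.Cruxes.BlochSeedDiscOne.B3SurplusLadder

open Finset

/-! ## §1 Box designs over a cell type: masses, feeders, surplus, Hall rows, margins -/

/-- A BOX DESIGN over a cell type `V`: the supports `A, N, C` of the three terms of a monad `𝒜 → 𝒩 → 𝒞` and their integer
multiplicities (field for field g2's `BoxMonad` at `V = MCell`). -/
structure BoxDesign (V : Type*) where
  A : Finset V
  N : Finset V
  C : Finset V
  mA : V → ℤ
  mN : V → ℤ
  mC : V → ℤ

section Generic

variable {V : Type*}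

/-- the MASS of a block: `Σ_{Z ∈ S} m(Z)`. -/
def mass (m : V → ℤ) (S : Finset V) : ℤ := ∑ Z ∈ S, m Z

theorem mass_empty (m : V → ℤ) : mass m (∅ : Finset V) = 0 := by simp [mass]

theorem mass_mono {m : V → ℤ} {s t : Finset V} (hst : s ⊆ t) (hpos : ∀ i ∈ t, 0 ≤ m i) : mass m s ≤ mass m t :=
  Finset.sum_le_sum_of_subset_of_nonneg hst fun i hi _ => hpos i hi

/-- the FEEDERS of a `C`-block `Γ` under the live relation `L`: the `N`-cells with a live arc into `Γ`. -/
def nbC (L : V → V → Prop) [DecidableRel L] (D : BoxDesign V) (Γ : Finset V) : Finset V :=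
  D.N.filter fun n => ∃ c ∈ Γ, L n c

/-- the RECEIVERS of an `A`-block `Γ`: the `N`-cells with a live arc from `Γ`. -/
def nbA (L : V → V → Prop) [DecidableRel L] (D : BoxDesign V) (Γ : Finset V) : Finset V :=
  D.N.filter fun n => ∃ a ∈ Γ, L a n

theorem nbC_subset (L : V → V → Prop) [DecidableRel L] (D : BoxDesign V) (Γ : Finset V) : nbC L D Γ ⊆ D.N :=
  Finset.filter_subset _ _

theorem nbA_subset (L : V → V → Prop) [DecidableRel L] (D : BoxDesign V) (Γ : Finset V) : nbA L D Γ ⊆ D.N :=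
  Finset.filter_subset _ _

theorem nbC_empty (L : V → V → Prop) [DecidableRel L] (D : BoxDesign V) : nbC L D ∅ = ∅ := by
  ext n; simp [nbC]

theorem nbA_empty (L : V → V → Prop) [DecidableRel L] (D : BoxDesign V) : nbA L D ∅ = ∅ := by
  ext n; simp [nbA]

/-- the SURPLUS of a `C`-block: `s(Γ) = m_N(N(Γ)) − m_C(Γ)` (memo §1; THEOREM Q: the non-surjective pattern matrices have
codimension `≥ min_Γ s(Γ) + 1`). -/
def surplusC (L : V → V → Prop) [DecidableRel L] (D : BoxDesign V) (Γ : Finset V) : ℤ :=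
  mass D.mN (nbC L D Γ) - mass D.mC Γ

/-- the SURPLUS of an `A`-block (transpose side): `s′(Γ′) = m_N(N(Γ′)) − m_A(Γ′)`. -/
def surplusA (L : V → V → Prop) [DecidableRel L] (D : BoxDesign V) (Γ : Finset V) : ℤ :=
  mass D.mN (nbA L D Γ) - mass D.mA Γ

/-- g0∕g2's Hall row (B3.2), `q`-side: every `C`-block is fed by at least its mass. -/
def HallQ (L : V → V → Prop) [DecidableRel L] (D : BoxDesign V) : Prop :=
  ∀ Γ ∈ D.C.powerset, mass D.mC Γ ≤ mass D.mN (nbC L D Γ)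

/-- Hall row (B3.3), `i`-side. -/
def HallI (L : V → V → Prop) [DecidableRel L] (D : BoxDesign V) : Prop :=
  ∀ Γ ∈ D.A.powerset, mass D.mA Γ ≤ mass D.mN (nbA L D Γ)

/-- g2's STRICT Hall row, `q`-side (no tight non-empty block). -/
def StrictHallQ (L : V → V → Prop) [DecidableRel L] (D : BoxDesign V) : Prop :=
  ∀ Γ ∈ D.C.powerset, Γ.Nonempty → mass D.mC Γ < mass D.mN (nbC L D Γ)

/-- strict Hall row, `i`-side. -/
def StrictHallI (L : V → V → Prop) [DecidableRel L] (D : BoxDesign V) : Prop :=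
  ∀ Γ ∈ D.A.powerset, Γ.Nonempty → mass D.mA Γ < mass D.mN (nbA L D Γ)

/-- **THE RUNG `d` OF THE SURPLUS LADDER, `q`-side**: every non-empty `C`-block has surplus `≥ d` under the pattern `L`.
Rung `0` is NECESSARY on every non-empty stratum; rung `dim Σ` is SUFFICIENT for a generic `q` (memo THEOREM Q, LEMMA N). -/
def MarginQ (L : V → V → Prop) [DecidableRel L] (D : BoxDesign V) (d : ℤ) : Prop :=
  ∀ Γ ∈ D.C.powerset, Γ.Nonempty → d ≤ surplusC L D Γ

/-- the rung `d`, `i`-side (every non-empty `A`-block has transpose surplus `≥ d`). -/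
def MarginI (L : V → V → Prop) [DecidableRel L] (D : BoxDesign V) (d : ℤ) : Prop :=
  ∀ Γ ∈ D.A.powerset, Γ.Nonempty → d ≤ surplusA L D Γ

/-! ## §2 Rungs 0 and 1 are the Hall rows of record; monotonicity in the rung and in the pattern -/

theorem hallQ_iff_marginQ_zero (L : V → V → Prop) [DecidableRel L] (D : BoxDesign V) : HallQ L D ↔ MarginQ L D 0 := by
  constructor
  · intro h Γ hΓ _
    have := h Γ hΓ
    unfold surplusC; linarith
  · intro h Γ hΓ
    rcases Γ.eq_empty_or_nonempty with rfl | hne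
    · rw [nbC_empty, mass_empty, mass_empty]
    · have := h Γ hΓ hne
      unfold surplusC at this; linarith

theorem hallI_iff_marginI_zero (L : V → V → Prop) [DecidableRel L] (D : BoxDesign V) : HallI L D ↔ MarginI L D 0 := by
  constructor
  · intro h Γ hΓ _
    have := h Γ hΓ
    unfold surplusA; linarith
  · intro h Γ hΓ
    rcases Γ.eq_empty_or_nonempty with rfl | hne
    · rw [nbA_empty, mass_empty, mass_empty]
    · have := h Γ hΓ hne
      unfold surplusA at this; linarith

theorem strictHallQ_iff_marginQ_one (L : V → V → Prop) [DecidableRel L] (D : BoxDesign V) :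
    StrictHallQ L D ↔ MarginQ L D 1 := by
  constructor
  · intro h Γ hΓ hne
    have := h Γ hΓ hne
    unfold surplusC; linarith
  · intro h Γ hΓ hne
    have := h Γ hΓ hne
    unfold surplusC at this; linarith

theorem strictHallI_iff_marginI_one (L : V → V → Prop) [DecidableRel L] (D : BoxDesign V) :
    StrictHallI L D ↔ MarginI L D 1 := by
  constructor
  · intro h Γ hΓ hne
    have := h Γ hΓ hne
    unfold surplusA; linarith
  · intro h Γ hΓ hne
    have := h Γ hΓ hne
    unfold surplusA at this; linarith

/-- the ladder is monotone in the rung. -/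
theorem marginQ_mono (L : V → V → Prop) [DecidableRel L] (D : BoxDesign V) {d d' : ℤ} (hd : d' ≤ d)
    (h : MarginQ L D d) : MarginQ L D d' :=
  fun Γ hΓ hne => le_trans hd (h Γ hΓ hne)

theorem marginI_mono (L : V → V → Prop) [DecidableRel L] (D : BoxDesign V) {d d' : ℤ} (hd : d' ≤ d)
    (h : MarginI L D d) : MarginI L D d' :=
  fun Γ hΓ hne => le_trans hd (h Γ hΓ hne)

/-- any non-negative rung contains the Hall row. -/
theorem hallQ_of_marginQ (L : V → V → Prop) [DecidableRel L] (D : BoxDesign V) {d : ℤ} (hd : 0 ≤ d)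
    (h : MarginQ L D d) : HallQ L D :=
  (hallQ_iff_marginQ_zero L D).2 (marginQ_mono L D hd h)

theorem hallI_of_marginI (L : V → V → Prop) [DecidableRel L] (D : BoxDesign V) {d : ℤ} (hd : 0 ≤ d)
    (h : MarginI L D d) : HallI L D :=
  (hallI_iff_marginI_zero L D).2 (marginI_mono L D hd h)

/-- rung `≥ 1` contains the strict Hall row (hence, by g2's `ks_of_strict`, the Kraft–Schwarzenberger tight-block law holds
vacuously). -/
theorem strictHallQ_of_marginQ (L : V → V → Prop) [DecidableRel L] (D : BoxDesign V) {d : ℤ} (hd : 1 ≤ d)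
    (h : MarginQ L D d) : StrictHallQ L D :=
  (strictHallQ_iff_marginQ_one L D).2 (marginQ_mono L D hd h)

theorem strictHallI_of_marginI (L : V → V → Prop) [DecidableRel L] (D : BoxDesign V) {d : ℤ} (hd : 1 ≤ d)
    (h : MarginI L D d) : StrictHallI L D :=
  (strictHallI_iff_marginI_one L D).2 (marginI_mono L D hd h)

/-- FEWER live arcs, fewer feeders. -/
theorem nbC_mono {L L' : V → V → Prop} [DecidableRel L] [DecidableRel L'] (hLL : ∀ x y, L' x y → L x y)
    (D : BoxDesign V) (Γ : Finset V) : nbC L' D Γ ⊆ nbC L D Γ := by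
  intro n hn
  simp only [nbC, Finset.mem_filter] at hn ⊢
  obtain ⟨hN, c, hc, hl⟩ := hn
  exact ⟨hN, c, hc, hLL _ _ hl⟩

theorem nbA_mono {L L' : V → V → Prop} [DecidableRel L] [DecidableRel L'] (hLL : ∀ x y, L' x y → L x y)
    (D : BoxDesign V) (Γ : Finset V) : nbA L' D Γ ⊆ nbA L D Γ := by
  intro n hn
  simp only [nbA, Finset.mem_filter] at hn ⊢
  obtain ⟨hN, a, ha, hl⟩ := hn
  exact ⟨hN, a, ha, hLL _ _ hl⟩

/-- the surplus of a block can only DROP when arcs are removed (non-negative `N`-multiplicities). -/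
theorem surplusC_mono_rel {L L' : V → V → Prop} [DecidableRel L] [DecidableRel L'] (hLL : ∀ x y, L' x y → L x y)
    (D : BoxDesign V) (hpos : ∀ n ∈ D.N, 0 ≤ D.mN n) (Γ : Finset V) : surplusC L' D Γ ≤ surplusC L D Γ := by
  have := mass_mono (m := D.mN) (nbC_mono hLL D Γ) fun i hi => hpos i (nbC_subset L D Γ hi)
  unfold surplusC; linarith

theorem surplusA_mono_rel {L L' : V → V → Prop} [DecidableRel L] [DecidableRel L'] (hLL : ∀ x y, L' x y → L x y)
    (D : BoxDesign V) (hpos : ∀ n ∈ D.N, 0 ≤ D.mN n) (Γ : Finset V) : surplusA L' D Γ ≤ surplusA L D Γ := by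
  have := mass_mono (m := D.mN) (nbA_mono hLL D Γ) fun i hi => hpos i (nbA_subset L D Γ hi)
  unfold surplusA; linarith

/-- **PATTERN MONOTONICITY OF THE LADDER.**  A rung that holds under a FINER pattern `L′ ≤ L` holds under `L`.  Use: the
NECESSARY rung `0` on a stratum, being necessary under the true (finer) pattern, is a fortiori a valid necessary test under the
coarse relation of record; a SUFFICIENT rung verified only under the coarse relation says nothing about a finer labelling. -/
theorem marginQ_of_finer {L L' : V → V → Prop} [DecidableRel L] [DecidableRel L'] (hLL : ∀ x y, L' x y → L x y)
    (D : BoxDesign V) (hpos : ∀ n ∈ D.N, 0 ≤ D.mN n) {d : ℤ} (h : MarginQ L' D d) : MarginQ L D d :=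
  fun Γ hΓ hne => le_trans (h Γ hΓ hne) (surplusC_mono_rel hLL D hpos Γ)

theorem marginI_of_finer {L L' : V → V → Prop} [DecidableRel L] [DecidableRel L'] (hLL : ∀ x y, L' x y → L x y)
    (D : BoxDesign V) (hpos : ∀ n ∈ D.N, 0 ≤ D.mN n) {d : ℤ} (h : MarginI L' D d) : MarginI L D d :=
  fun Γ hΓ hne => le_trans (h Γ hΓ hne) (surplusA_mono_rel hLL D hpos Γ)

/-! ## §3 Strata: the pattern off a wall set, and the ladder over a stratum index -/

/-- the pattern LIVE ON A STRATUM: the arcs of `L` not killed by the wall predicate `W` (an arc `n → c` is killed on `Σ` when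
`Σ ⊆ Bs|Hom(L_n, L_c)|`; memo §3 BASE-LOCUS TABLE).  An `abbrev`, so that decidability is inherited. -/
abbrev offWall (L W : V → V → Prop) : V → V → Prop := fun x y => L x y ∧ ¬ W x y

theorem offWall_le (L W : V → V → Prop) : ∀ x y, offWall L W x y → L x y := fun _ _ h => h.1

/-- a rung on a wall stratum implies the same rung on the open stratum (walls only remove arcs). -/
theorem marginQ_offWall {L W : V → V → Prop} [DecidableRel L] [DecidableRel W] (D : BoxDesign V)
    (hpos : ∀ n ∈ D.N, 0 ≤ D.mN n) {d : ℤ} (h : MarginQ (offWall L W) D d) : MarginQ L D d :=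
  marginQ_of_finer (offWall_le L W) D hpos h

theorem marginI_offWall {L W : V → V → Prop} [DecidableRel L] [DecidableRel W] (D : BoxDesign V)
    (hpos : ∀ n ∈ D.N, 0 ≤ D.mN n) {d : ℤ} (h : MarginI (offWall L W) D d) : MarginI L D d :=
  marginI_of_finer (offWall_le L W) D hpos h

/-- **THE SURPLUS LADDER, `q`-side**, over a stratum index `ι`: stratum `i` carries the live pattern `Ls i` and the required
rung `d i` (`d i = 0`: the necessary ladder on non-empty strata; `d i = dim Σ_i`: the sufficient ladder). -/
def LadderQ {ι : Type*} (Ls : ι → V → V → Prop) [∀ i, DecidableRel (Ls i)] (D : BoxDesign V) (d : ι → ℤ) : Prop :=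
  ∀ i, MarginQ (Ls i) D (d i)

/-- the surplus ladder, `i`-side. -/
def LadderI {ι : Type*} (Ls : ι → V → V → Prop) [∀ i, DecidableRel (Ls i)] (D : BoxDesign V) (d : ι → ℤ) : Prop :=
  ∀ i, MarginI (Ls i) D (d i)

theorem ladderQ_mono {ι : Type*} (Ls : ι → V → V → Prop) [∀ i, DecidableRel (Ls i)] (D : BoxDesign V) {d d' : ι → ℤ}
    (hd : ∀ i, d' i ≤ d i) (h : LadderQ Ls D d) : LadderQ Ls D d' :=
  fun i => marginQ_mono (Ls i) D (hd i) (h i)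

theorem ladderI_mono {ι : Type*} (Ls : ι → V → V → Prop) [∀ i, DecidableRel (Ls i)] (D : BoxDesign V) {d d' : ι → ℤ}
    (hd : ∀ i, d' i ≤ d i) (h : LadderI Ls D d) : LadderI Ls D d' :=
  fun i => marginI_mono (Ls i) D (hd i) (h i)

/-- the sufficient ladder (rungs `dim Σ_i ≥ 0`) contains the necessary ladder (rungs `0`). -/
theorem necessary_of_sufficient {ι : Type*} (Ls : ι → V → V → Prop) [∀ i, DecidableRel (Ls i)] (D : BoxDesign V)
    {dim : ι → ℤ} (hdim : ∀ i, 0 ≤ dim i) (hQ : LadderQ Ls D dim) (hI : LadderI Ls D dim) :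
    LadderQ Ls D (fun _ => 0) ∧ LadderI Ls D (fun _ => 0) :=
  ⟨ladderQ_mono Ls D hdim hQ, ladderI_mono Ls D hdim hI⟩

/-! ## §4 Certificates: a supply flow proves a rung (weak duality), a printed block refutes one -/

/-- A FLOW CERTIFICATE for the rung `k`, `q`-side: a non-negative integral flow on live arcs `n → c` (`n ∈ N`), using at most
the supply `m_N(n)` out of each feeder and delivering at least `m_C(c) + k` into each receiver `c ∈ C`.  For `k = 8` this is
(a multiplicity form of) unipotent-1 g7's SUP plan with private copies. -/
structure FlowCertQ (L : V → V → Prop) (D : BoxDesign V) (k : ℤ) where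
  /-- the flow on arcs `n → c` -/
  f : V → V → ℤ
  nonneg : ∀ n c, 0 ≤ f n c
  live : ∀ n c, f n c ≠ 0 → n ∈ D.N ∧ L n c
  supply : ∀ n ∈ D.N, ∑ c ∈ D.C, f n c ≤ D.mN n
  demand : ∀ c ∈ D.C, D.mC c + k ≤ ∑ n ∈ D.N, f n c

/-- A FLOW CERTIFICATE for the rung `k`, `i`-side: a flow on live arcs `a → n` (`n ∈ N`) absorbing at least `m_A(a) + k` out
of each `a ∈ A` and at most `m_N(n)` into each `n`. -/
structure FlowCertI (L : V → V → Prop) (D : BoxDesign V) (k : ℤ) where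
  /-- the flow on arcs `a → n` -/
  f : V → V → ℤ
  nonneg : ∀ a n, 0 ≤ f a n
  live : ∀ a n, f a n ≠ 0 → n ∈ D.N ∧ L a n
  supply : ∀ n ∈ D.N, ∑ a ∈ D.A, f a n ≤ D.mN n
  demand : ∀ a ∈ D.A, D.mA a + k ≤ ∑ n ∈ D.N, f a n

/-- **WEAK DUALITY: a flow certificate proves the rung.**  (Max-flow∕min-cut says the converse holds for the rung per CELL;
for the rung per BLOCK it fails — §5.) -/
theorem marginQ_of_flowCert {L : V → V → Prop} [DecidableRel L] {D : BoxDesign V} {k : ℤ} (hk : 0 ≤ k)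
    (F : FlowCertQ L D k) : MarginQ L D k := by
  intro Γ hΓ hne
  have hΓC : Γ ⊆ D.C := Finset.mem_powerset.mp hΓ
  -- (1) demand summed over the block
  have h1 : mass D.mC Γ + k ≤ ∑ c ∈ Γ, ∑ n ∈ D.N, F.f n c := by
    have hsum : ∑ c ∈ Γ, (D.mC c + k) ≤ ∑ c ∈ Γ, ∑ n ∈ D.N, F.f n c :=
      Finset.sum_le_sum fun c hc => F.demand c (hΓC hc)
    have hcard : (1 : ℤ) ≤ Γ.card := by exact_mod_cast hne.card_pos
    have hsplit : ∑ c ∈ Γ, (D.mC c + k) = mass D.mC Γ + Γ.card * k := by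
      rw [Finset.sum_add_distrib, Finset.sum_const, nsmul_eq_mul]; rfl
    have hkk : k ≤ Γ.card * k := le_mul_of_one_le_left hk hcard
    linarith
  -- (2) exchange the sums
  have h2 : ∑ c ∈ Γ, ∑ n ∈ D.N, F.f n c = ∑ n ∈ D.N, ∑ c ∈ Γ, F.f n c := Finset.sum_comm
  -- (3) a feeder outside `N(Γ)` sends nothing into `Γ`
  have h3 : ∑ n ∈ D.N, ∑ c ∈ Γ, F.f n c = ∑ n ∈ nbC L D Γ, ∑ c ∈ Γ, F.f n c := by
    symm
    apply Finset.sum_subset (nbC_subset L D Γ)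
    intro n hn hnot
    apply Finset.sum_eq_zero
    intro c hc
    by_contra hne0
    apply hnot
    simp only [nbC, Finset.mem_filter]
    exact ⟨hn, c, hc, (F.live n c hne0).2⟩
  -- (4) each feeder sends at most its supply
  have h4 : ∑ n ∈ nbC L D Γ, ∑ c ∈ Γ, F.f n c ≤ mass D.mN (nbC L D Γ) := by
    unfold mass
    apply Finset.sum_le_sum
    intro n hn
    have hnN : n ∈ D.N := nbC_subset L D Γ hn
    calc ∑ c ∈ Γ, F.f n c ≤ ∑ c ∈ D.C, F.f n c :=
          Finset.sum_le_sum_of_subset_of_nonneg hΓC fun c _ _ => F.nonneg n c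
      _ ≤ D.mN n := F.supply n hnN
  unfold surplusC; linarith

/-- weak duality, `i`-side. -/
theorem marginI_of_flowCert {L : V → V → Prop} [DecidableRel L] {D : BoxDesign V} {k : ℤ} (hk : 0 ≤ k)
    (F : FlowCertI L D k) : MarginI L D k := by
  intro Γ hΓ hne
  have hΓA : Γ ⊆ D.A := Finset.mem_powerset.mp hΓ
  have h1 : mass D.mA Γ + k ≤ ∑ a ∈ Γ, ∑ n ∈ D.N, F.f a n := by
    have hsum : ∑ a ∈ Γ, (D.mA a + k) ≤ ∑ a ∈ Γ, ∑ n ∈ D.N, F.f a n :=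
      Finset.sum_le_sum fun a ha => F.demand a (hΓA ha)
    have hcard : (1 : ℤ) ≤ Γ.card := by exact_mod_cast hne.card_pos
    have hsplit : ∑ a ∈ Γ, (D.mA a + k) = mass D.mA Γ + Γ.card * k := by
      rw [Finset.sum_add_distrib, Finset.sum_const, nsmul_eq_mul]; rfl
    have hkk : k ≤ Γ.card * k := le_mul_of_one_le_left hk hcard
    linarith
  have h2 : ∑ a ∈ Γ, ∑ n ∈ D.N, F.f a n = ∑ n ∈ D.N, ∑ a ∈ Γ, F.f a n := Finset.sum_comm
  have h3 : ∑ n ∈ D.N, ∑ a ∈ Γ, F.f a n = ∑ n ∈ nbA L D Γ, ∑ a ∈ Γ, F.f a n := by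
    symm
    apply Finset.sum_subset (nbA_subset L D Γ)
    intro n hn hnot
    apply Finset.sum_eq_zero
    intro a ha
    by_contra hne0
    apply hnot
    simp only [nbA, Finset.mem_filter]
    exact ⟨hn, a, ha, (F.live a n hne0).2⟩
  have h4 : ∑ n ∈ nbA L D Γ, ∑ a ∈ Γ, F.f a n ≤ mass D.mN (nbA L D Γ) := by
    unfold mass
    apply Finset.sum_le_sum
    intro n hn
    have hnN : n ∈ D.N := nbA_subset L D Γ hn
    calc ∑ a ∈ Γ, F.f a n ≤ ∑ a ∈ D.A, F.f a n :=
          Finset.sum_le_sum_of_subset_of_nonneg hΓA fun a _ _ => F.nonneg a n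
      _ ≤ D.mN n := F.supply n hnN
  unfold surplusA; linarith

/-- unipotent-1 g7's LEMMA SUP in ladder form: a private-copies plan with margin 8 (a flow certificate for `k = 8`) proves the
sufficient rung of the OPEN stratum (`dim X = 8`). -/
theorem marginQ_eight_of_plan {L : V → V → Prop} [DecidableRel L] {D : BoxDesign V} (F : FlowCertQ L D 8) :
    MarginQ L D 8 :=
  marginQ_of_flowCert (by norm_num) F

theorem marginI_eight_of_plan {L : V → V → Prop} [DecidableRel L] {D : BoxDesign V} (F : FlowCertI L D 8) :
    MarginI L D 8 :=
  marginI_of_flowCert (by norm_num) F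

/-- **A PRINTED BLOCK REFUTES A RUNG** (the FAIL certificate of the machine table). -/
theorem not_marginQ_of_block {L : V → V → Prop} [DecidableRel L] {D : BoxDesign V} {Γ : Finset V} {d : ℤ}
    (hΓ : Γ ⊆ D.C) (hne : Γ.Nonempty) (hlt : surplusC L D Γ < d) : ¬ MarginQ L D d :=
  fun h => absurd (h Γ (Finset.mem_powerset.mpr hΓ) hne) (not_le.mpr hlt)

theorem not_marginI_of_block {L : V → V → Prop} [DecidableRel L] {D : BoxDesign V} {Γ : Finset V} {d : ℤ}
    (hΓ : Γ ⊆ D.A) (hne : Γ.Nonempty) (hlt : surplusA L D Γ < d) : ¬ MarginI L D d :=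
  fun h => absurd (h Γ (Finset.mem_powerset.mpr hΓ) hne) (not_le.mpr hlt)

end Generic

/-! ## §5 SUP ⊊ LADDER: the block `𝒪^{10} → L₁ ⊕ L₂` -/

/-- the toy `𝒪^{10} → L₁ ⊕ L₂`: one feeder (cell `0`, mass `10`), two receivers (cells `1, 2`, mass `1` each), every arc
`0 → c` live. -/
def supToy : BoxDesign (Fin 3) where
  A := ∅
  N := {0}
  C := {1, 2}
  mA := fun _ => 0
  mN := fun Z => if Z = 0 then 10 else 0
  mC := fun Z => if Z = 0 then 0 else 1

/-- the toy's live relation: arcs out of the feeder `0` into `1` and `2`. -/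
abbrev supToyLive : Fin 3 → Fin 3 → Prop := fun x y => x = 0 ∧ y ≠ 0

/-- the toy passes the sufficient rung `8` of the open stratum: surpluses `9, 9, 8`. -/
theorem supToy_marginQ_eight : MarginQ supToyLive supToy 8 := by
  unfold MarginQ surplusC mass nbC supToy
  decide

/-- … and rung `9` fails on the full block (surplus `10 − 2 = 8`). -/
theorem supToy_not_marginQ_nine : ¬ MarginQ supToyLive supToy 9 := by
  unfold MarginQ surplusC mass nbC supToy
  decide

/-- … but NO private-copies plan with margin `8` exists: the two receivers would each need `9` out of a supply of `10`.
Hence the sufficient rung (THEOREM Q) is STRICTLY weaker than LEMMA SUP's hypothesis. -/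
theorem supToy_no_flowCert (F : FlowCertQ supToyLive supToy 8) : False := by
  have hs := F.supply 0 (by decide)
  have h1 := F.demand 1 (by decide)
  have h2 := F.demand 2 (by decide)
  simp only [supToy] at hs h1 h2
  rw [Finset.sum_pair (by decide)] at hs
  rw [Finset.sum_singleton] at h1 h2
  simp at hs h1 h2
  linarith

/-! ## §6 The cell's instance: `V = MCell`, relation of record `MCell.le` -/

section Cell

open Summit.Ventures.HSemireg.Pad4Tower

/-- a box design on 𝔅(μ₄)⁴ cells (g2's `BoxMonad`, field for field). -/
abbrev CellDesign := BoxDesign MCell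

/-- NECESSARY rungs transfer to the coarse relation of record: if the rung `d` holds under any labelling's live pattern
`L′ ≤ MCell.le` (fewer arcs), it holds under `MCell.le`.  (So a rung-`0` FAILURE printed under `MCell.le` kills every labelling —
g2's Rule A in ladder form.) -/
theorem marginQ_le_of_sub {L' : MCell → MCell → Prop} [DecidableRel L'] (hL : ∀ x y, L' x y → MCell.le x y)
    (D : CellDesign) (hpos : ∀ n ∈ D.N, 0 ≤ D.mN n) {d : ℤ} (h : MarginQ L' D d) : MarginQ MCell.le D d :=
  marginQ_of_finer hL D hpos h

theorem marginI_le_of_sub {L' : MCell → MCell → Prop} [DecidableRel L'] (hL : ∀ x y, L' x y → MCell.le x y)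
    (D : CellDesign) (hpos : ∀ n ∈ D.N, 0 ≤ D.mN n) {d : ℤ} (h : MarginI L' D d) : MarginI MCell.le D d :=
  marginI_of_finer hL D hpos h

/-! ## §7 The datum of the block-Porteous rows: the class-frame Chern character of the virtual block bundles -/

/-- `ch(𝒩_{N(Γ)} − 𝒞_Γ)` in the class frame of record (word functions over `ℤ[i]`, the tree's `MCell.ch`): the DATUM of the
block-Porteous rows `(BP)_s : c_{s+1}(𝒩_{N(Γ)} − 𝒞_Γ) = 0` (`s = s(Γ) ≤ 7`; memo §2).  The Chern CLASSES `c_{s+1}` are Newton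
polynomials in the graded pieces of this character and need the frame's cup product (`uv = p`, `eē = −p` per factor), which
the tree does not carry; the machine table evaluates them exactly. -/
def blockChQ (L : MCell → MCell → Prop) [DecidableRel L] (D : CellDesign) (Γ : Finset MCell) : CWord → GaussianInt :=
  fun w => (∑ n ∈ nbC L D Γ, (D.mN n : GaussianInt) * n.ch w) - ∑ c ∈ Γ, (D.mC c : GaussianInt) * c.ch w

/-- `ch(𝒩_{N(Γ′)} − 𝒜_{Γ′})`, the `i`-side datum (Fulton Ex. 14.4.1). -/
def blockChA (L : MCell → MCell → Prop) [DecidableRel L] (D : CellDesign) (Γ : Finset MCell) : CWord → GaussianInt :=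
  fun w => (∑ n ∈ nbA L D Γ, (D.mN n : GaussianInt) * n.ch w) - ∑ a ∈ Γ, (D.mA a : GaussianInt) * a.ch w

/-- **(BP)₀, `q`-side** — the surplus-`0` block-Porteous row: `c₁(𝒩_{N(Γ)} − 𝒞_Γ) = 0`, i.e. every DEGREE-ONE word of the
block character vanishes (for a TIGHT block this is the `c₁` face of g2's tight-block law; Fulton Thm 14.4(a) with `e = f`). -/
def BPZeroQ (L : MCell → MCell → Prop) [DecidableRel L] (D : CellDesign) (Γ : Finset MCell) : Prop :=
  ∀ w : CWord, wdeg w = 1 → blockChQ L D Γ w = 0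

/-- (BP)₀, `i`-side. -/
def BPZeroA (L : MCell → MCell → Prop) [DecidableRel L] (D : CellDesign) (Γ : Finset MCell) : Prop :=
  ∀ w : CWord, wdeg w = 1 → blockChA L D Γ w = 0

/-- the necessary surplus-`0` ladder-plus-Porteous row on the open stratum, `q`-side: Hall, and (BP)₀ on every TIGHT block
(memo LEMMA N + (BP) at `s = 0`). -/
def NecessaryOpenQ (L : MCell → MCell → Prop) [DecidableRel L] (D : CellDesign) : Prop :=
  MarginQ L D 0 ∧ ∀ Γ ∈ D.C.powerset, Γ.Nonempty → surplusC L D Γ = 0 → BPZeroQ L D Γ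

/-- the same, `i`-side. -/
def NecessaryOpenI (L : MCell → MCell → Prop) [DecidableRel L] (D : CellDesign) : Prop :=
  MarginI L D 0 ∧ ∀ Γ ∈ D.A.powerset, Γ.Nonempty → surplusA L D Γ = 0 → BPZeroA L D Γ

/-- rung `≥ 1` makes the tight-block clause vacuous: the necessary open-stratum row reduces to the margin. -/
theorem necessaryOpenQ_of_marginQ_pos (L : MCell → MCell → Prop) [DecidableRel L] (D : CellDesign) {d : ℤ} (hd : 1 ≤ d)
    (h : MarginQ L D d) : NecessaryOpenQ L D := by
  refine ⟨marginQ_mono L D (by linarith) h, ?_⟩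
  intro Γ hΓ hne hs
  have := h Γ hΓ hne
  exact absurd hs (by linarith)

theorem necessaryOpenI_of_marginI_pos (L : MCell → MCell → Prop) [DecidableRel L] (D : CellDesign) {d : ℤ} (hd : 1 ≤ d)
    (h : MarginI L D d) : NecessaryOpenI L D := by
  refine ⟨marginI_mono L D (by linarith) h, ?_⟩
  intro Γ hΓ hne hs
  have := h Γ hΓ hne
  exact absurd hs (by linarith)

end Cell

end Summit.HodgeConjecture.HodgeConjecture.Cruxes.BlochSeedDiscOne.B3SurplusLadder
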